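import Mathlib

/-!
# SoloBlind — a hidden reversible sub-family of the meander carriers (SEIL-F design trap)

Solo programme `solo-AnomalousDissipation-blind`, paper §24.11 / claim SB-C248.
The SEIL-F meander carriers are `ψ₀ = -U y + p̃`, with
`p̃ = A sin y + b (sin 2x · sin y + r sin (2x + y + γ))`; the leaf-moment coefficient `κ`
must not vanish on any leaf, and it vanishes identically on REVERSIBLE carriers (those even
in `x` about some `x₀`; kernel file `SoloBlindReversibleLeafMoment`). Numerically `κ ≡ 0` was
found on the whole sub-family `r = sin γ`. The reason is the elementary identity below: for
`r = sin γ` the perturbation is SEPARABLE, `p̃ = A sin y + b sin (2x + γ) sin (y + γ)`, hence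
even about `x₀ = π/4 - γ/2` — the reversible class in disguise. (Design rule: stay off
`r = sin γ`; at leading order `κ ∝ b² r (r - sin γ)`.)
-/

namespace Summit.AnomalousDissipation.AnomalousDissipation.Theorems

open Real

/-- The identity behind the trap: `sin y + sin γ cos (y + γ) = cos γ sin (y + γ)`. -/
theorem sin_add_sin_mul_cos_add (y γ : ℝ) :
    sin y + sin γ * cos (y + γ) = cos γ * sin (y + γ) := by
  rw [cos_add, sin_add]
  have h := sin_sq_add_cos_sq γ
  linear_combination (-(sin y)) * h

/-- On `r = sin γ` the meander perturbation is separable: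
`A sin y + b (sin 2x sin y + sin γ sin (2x + y + γ)) = A sin y + b sin (2x + γ) sin (y + γ)`. -/
theorem meander_separable_of_r_eq_sin (A b γ x y : ℝ) :
    A * sin y + b * (sin (2 * x) * sin y + sin γ * sin (2 * x + y + γ))
      = A * sin y + b * (sin (2 * x + γ) * sin (y + γ)) := by
  have e1 : sin (2 * x + y + γ) = sin (2 * x) * cos (y + γ) + cos (2 * x) * sin (y + γ) := by
    rw [show 2 * x + y + γ = 2 * x + (y + γ) by ring, sin_add]
  have e2 : sin (2 * x + γ) = sin (2 * x) * cos γ + cos (2 * x) * sin γ := sin_add _ _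
  rw [e1, e2]
  have h := sin_add_sin_mul_cos_add y γ
  -- the difference of the two sides is b sin 2x · (sin y + sin γ cos(y+γ) - cos γ sin(y+γ))
  linear_combination (b * sin (2 * x)) * h

/-- Hence the `r = sin γ` carrier is REVERSIBLE: the separable perturbation is even under the
reflection `x ↦ π/2 - γ - x` (i.e. about `x₀ = π/4 - γ/2`), for every `y`. -/
theorem meander_separable_even (A b γ x y : ℝ) :
    A * sin y + b * (sin (2 * (π / 2 - γ - x) + γ) * sin (y + γ))
      = A * sin y + b * (sin (2 * x + γ) * sin (y + γ)) := by
  have : sin (2 * (π / 2 - γ - x) + γ) = sin (2 * x + γ) := by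
    rw [show 2 * (π / 2 - γ - x) + γ = π - (2 * x + γ) by ring, sin_pi_sub]
  rw [this]

end Summit.AnomalousDissipation.AnomalousDissipation.Theorems
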